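import Summits.QuantumFields.YangMills.Theorems.BalabanUVNodesN12MinimiserFamilyKnitRowThm1LettersOnZ
import Summits.QuantumFields.YangMills.Theorems.BalabanUVNodesN12HsurjOfClass
import HarnessLib

/-!
# BalabanUVNodes ∕ N12 — THE KNIT's (J0′) ROW FOR EVERY BASE FIELD OF THE STRICT GUARD, OF RECORD: `N12MinimiserFamilyKnitRowThm1LettersOnZ.exists_R_hMinRow_of_thm1Letters_alongOrbit_onZ`
# with the per-height letters DISCHARGED (dag-n12-w6's `N12HsurjOfClass.exists_hsurjLetters`) — displayed: the record numerics, dag-n12-w6's (σ)_N numerics, the two CLOSED [15] letters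
# `h15T` ∕ `h15EUT`; announced: `ρ″`, `εH`, `δ₀`; then per window ∕ region box ∕ tolerances: `∃ R > 0, ∀ V_k, strict guard → <12Q ∕ 12X-W v11 hMin ∀-body, bound 4𝓐₀>`
# ([Balaban1985Variational] (1) p.277, (2)–(7) p.278, Thm 1 (8) p.279, Sect. C (44)–(48) p.285, (81)–(83) p.290, Sect. G pp.305–307, (181) p.307, Prop. 9 (190) p.309;
# [Balaban1989LargeFieldI] (1.74) p.192, p.193 ll.14–20, Prop. 1 p.194; [Balaban1985RegularSpaces] (1.3)–(1.9) p.77; [Balaban1989LargeFieldII] p.357, (1.7)–(1.9) p.358,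
# (1.12)–(1.13) p.359; [Balaban1988Convergent] (2.1)–(2.2) pp.254–255, (2.10)–(2.13) pp.256–257, (2.18) p.257; [Balaban1985Averaging] (8)–(9) pp.18–19, Prop. 2 (52)–(54) p.26,
# (122)–(126) p.36; [Balaban1987RG1] (0.4) p.253)

Cell `pub-ymgap` (HUMAN RULINGS D-0062 ∕ D-0149), seat `pub-ymgap-dag-n12-d` g25 (R134 N12 [B15] s2 = by-name knit at the record; census item E1 = the (J0′) row; count-neutral helper of K1⁹
`stmt-QuantumFields-27364`, `--kind proof --supports … --as helper`).  THEOREMS ONLY (0 `def`, 0 `instance`, 0 `sorry`); ONE composition BY NAME.  Seventh leaf of the junction family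
(own leaf for the 400-line rule; `…KnitRowThm1LettersOnZ` is 335 lines).

WHAT.  The onZ junction of record (`…KnitRowThm1LettersOnZ` §2, p734359) displays per (instance, height) the existence letters `ρ″`∕`hsbU` ([4]'s averaging smallness radius) and
`εH`∕`B`∕`hHB` (the bounded right inverse of the constrained chart's derivative) — inhabited, for every instance and height, by dag-n12-w6 g11's `N12HsurjOfClass.exists_hsurjLetters`
(`ρ″, εH` from `(Kt, k)` alone, `B` per `(M₁, Z)`).  THIS FILE discharges them: what stays displayed is the record numerics (`3 ≤ d`, `1 ≤ k`, `k + 1 ≤ m + K`, `LᵏM₁`-side ∣ `sitesPerDir 0`,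
`(d+14)L ≤ M₁`, `IsBlockUnion k Z`), the (σ)_N numerics (`hkc hc hMrad hM₁`) and the two CLOSED instance-independent [15] letters `h15T` ((8)) ∕ `h15EUT` (existence ∕ uniqueness modulo
tower-central gauges) over NODE 00's torus class; ANNOUNCED: `ρ″ > 0`, `εH > 0`, `δ₀ > 0`; then for every fine window with 12Q v11's geometry rows, print's region box (lit-balaban ME #45∕#46: print's own
scope — every class-(i) component of `Z` is a rectangular parallelepiped inside a `100MR_k`-cube, [Balaban1988Convergent] p.255 after (2.3), [Balaban1989LargeFieldI] (i) p.177; `Λ` a box), guard radius `eR` within the budget, extension, `𝓐₀ > 1`, class tolerance `εr` (five rows + [15]'s comparability rows at `ε := 2eR`), datum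
tolerance `ρn` (U3's «T ≤ δ₀» + the normaliser's coupling): `∃ R > 0, ∀ V_k, PlaqSmallOn (plaqsInside (pts k (Z ∩ Λᶜ))) eR V_k → <the knit's hMin ∀-body at V_k, radius R, bound 4𝓐₀,
class at εr>`.

HONEST FRAMING ∕ LOCATED.  One composition by name; [15] Thm 1 ((8), existence, uniqueness) stays DISPLAYED as the two closed letters `h15T`∕`h15EUT` (inhabitant = K0⁷ ∕ NODE 00's house,
not in the tree) — THE remaining substance of E1 on the knit side, together with census U4 (`δ₀`, `R`, `ρ″`, `εH` are EXISTENCE constants per (instance, height); print's volume-uniform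
(46)∕(83) and `k`-uniformity NOT claimed); box scope displayed; nothing of Bałaban's estimates asserted; count-neutral; N12 NOT discharged; K1⁹ NOT closed; counts unmoved; one finite 𝕋⁴
programme at fixed `ε = L^{-K}` — R4 closes only the conditional rung `BalabanLadder.UV`; no summit statement is proved here and NOT the Yang–Mills mass gap (Clay); nothing
continuum ∕ ℝ⁴ ∕ OS.
-/

noncomputable section

namespace Summit.QuantumFields.YangMills.BalabanUVNodes.N12MinimiserFamilyKnitRowThm1LettersOnZOfRecord

open scoped BigOperators Matrix.Norms.L2Operator Topology
open Literature.MathematicalPhysics.QuantumFieldTheory.Balaban1983to89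
open T4Continuum
open B15DeterminingSets GaugeField
open ExpMeanLog (expMeanLogSU deltaSU)
open T4AdjointCovarianceUnitary (lieSU)
open Node00
open B15Prop1AnalyticExtClause (cplxVec)
open B15Prop1ChartCalculusSU2 (E3)
open T4CubeChartGnomonic (SU2)
open B14.Eq213DetSet (Bj maxDomT)
open B14.Eq213MaximalDomains (side)
open B14.Eq22Determines (IsBlockUnion)
open B14.Eq216Concrete (feeds)
open B5Eq118OneStroke (iterBlockOf)
open B15Eq112TorusCover (lift)
open T4AxialGaugeSmallField (boxPlaqs castSite)
open B15Prop1Carrier (plaqsInside)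
open Literature.MathematicalPhysics.QuantumFieldTheory.BalabanImbrieJaffe1984to88.BIJ85Eq453GaugeField (qsstarGIter0)
open B15ShellGauge193 (shellGauge)
open B15Extension193 (extend)
open B16Sect1Backgrounds (toMS expMul)
open B15Prop1ChartSU2 (su2Chart)
open Metric (ball)
open B15Prop1ClosedGuardUniformRadius (isCompact_setOf_plaqLeOn plaqLeOn_of_plaqSmallOn)
open B15ShellGauge193Local (dist1_plaqHol_extend_shellGauge_le)
open B15Extension193 (cutoff primed Touches)
open B12ContinuousTransportInvarianceOn (continuous_dist1_SU)
open T4AxialGaugeSmallField (boxBonds)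
open B15Prop1MinimiserFamilyOfNormalisedSlice (hMinBody_of_datumSlice)
open Summit.QuantumFields.YangMills.BalabanUVNodes.N12MinimiserFamilyKnitRowThm1Letters (boxRow3_of_boxRow5 isCompact_guard_inter_datumSlice)
open Summit.QuantumFields.YangMills.BalabanUVNodes.N12MinimiserFamilyAtRecordBjTowerDatumLettersOnZUniform (hMin_atRecord_Bj_of_printLetters_ofClassDatumLettersOnZUniform)
open B15Prop1Thm1RowsOfExistsUnique (thm1Rows_atZ_of_thm1TorusClass_existsUnique)

open Summit.QuantumFields.YangMills.BalabanUVNodes.N12MinimiserFamilyKnitRowThm1LettersOnZ (exists_R_hMinRow_of_thm1Letters_alongOrbit_onZ)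
open Summit.QuantumFields.YangMills.BalabanUVNodes.N12HsurjOfClass (exists_hsurjLetters)

variable {F : T4Family} {k : ℕ}



/-! ## §1  The onZ orbit junction of record with the per-height letters discharged -/

/-- ★★★★★ **THE KNIT's (J0′) ROW FOR EVERY BASE FIELD OF THE STRICT GUARD, PER-HEIGHT LETTERS DISCHARGED** — `N12MinimiserFamilyKnitRowThm1LettersOnZ.
exists_R_hMinRow_of_thm1Letters_alongOrbit_onZ` ∘ dag-n12-w6's `N12HsurjOfClass.exists_hsurjLetters` (at `M₁ := ν.M₁`, `1 ≤ M₁` from the floor): displayed ONLY the record numerics,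
the (σ)_N numerics `hkc hc hMrad hM₁` and the two closed [15] letters `h15T`∕`h15EUT`; announced `ρ″ > 0`, `εH > 0`, `δ₀ > 0`; then per window (rows `hn hN5 hlohi hbox hZ`), region box
(`LO HI n′` rows + box scope), `cE` + budget, `ext`, `𝓐₀`, `εr` (five rows), `ε₀` (four comparability rows at `ε := 2eR`), `ρn` («T ≤ δ₀», coupling):
`∃ R > 0, ∀ V_k, strict guard → <12Q ∕ 12X-W v11 hMin ∀-body at V_k, bound 4𝓐₀, class at εr>`.
[cite: Balaban1985Variational, (2)–(7) p.278, Thm 1 (8) p.279, Sect. C (44)–(48) p.285, (81)–(83) p.290, Sect. G pp.305–307, (181) p.307, Prop. 9 (190) p.309; Balaban1989LargeFieldI, (i) p.177, (1.74) p.192, p.193 L14–20, Prop. 1 p.194; Balaban1988Convergent, p.255 (after (2.3)); Balaban1985RegularSpaces, (1.3)–(1.9) p.77; Balaban1989LargeFieldII, (1.12)–(1.13) p.359; Balaban1988Convergent, (2.1)–(2.2) pp.254–255, (2.10)–(2.13) pp.256–257, (2.18) p.257; Balaban1985Averaging, (8)–(9) pp.18–19, Prop. 2 (52)–(54) p.26,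 (122)–(126) p.36; Balaban1987RG1, (0.4) p.253] -/
theorem exists_R_hMinRow_of_thm1Letters_alongOrbit_onZ_ofRecord (ν : Node00.Stage7Numerics) (Kt : ℕ) (hd3 : 3 ≤ (F.P Kt).d) (Z : Set (Site (F.P Kt) 0))
    (hkK : k + 1 ≤ (F.P Kt).m + (F.P Kt).K) (hk1 : 1 ≤ k) (hdiv : side (F.P Kt).L ν.M₁ k ∣ (F.P Kt).sitesPerDir 0) (hfloor : ((F.P Kt).d + 14) * (F.P Kt).L ≤ ν.M₁) (hZblk : IsBlockUnion k Z)
    -- (σ)_N OF RECORD, onZ EDITION (dag-n12-w6 g18's `N12GaugeLetterLocExplicitOnZ.exists_gaugeLetterLoc_atRecord_explicit_onZ` inside the lane's U3-onZ), instance-level NUMERICS verbatim: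
    -- NUMERICS (i): a level guard `k + c ≤ m + K` with `4d + m′ + 3 < 2·L^c` (no wrapping), and `M₁ ≥ (4d + m′)·L² + 2d·L + 12` (radii), `m′ = 3·(d·((L−1)∕2)) + 5`
    {c : ℕ} (hkc : k + c ≤ (F.P Kt).m + (F.P Kt).K) (hc : 4 * (F.P Kt).d + (3 * ((F.P Kt).d * (((F.P Kt).L - 1) / 2)) + 5) + 3 < 2 * (F.P Kt).L ^ c)
    (hMrad : (4 * (F.P Kt).d + (3 * ((F.P Kt).d * (((F.P Kt).L - 1) / 2)) + 5)) * (F.P Kt).L ^ 2 + 2 * (F.P Kt).d * (F.P Kt).L + 12 ≤ ν.M₁)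
    -- the family's support numerics: `M₁ ≥ ((d+4)L + 6)·L²`
    (hM₁ : (((F.P Kt).d + 4) * (F.P Kt).L + 6) * (F.P Kt).L ^ 2 ≤ ν.M₁)
    -- THE TWO CLOSED, INSTANCE-INDEPENDENT [15] LETTERS over NODE 00's torus class (the lane's `h15T` ∕ `h15EUT`, VERBATIM)
    {B₃ a₀ a₁ : ℝ}
    (h15T : ∀ (k' : ℕ), k' ≤ (F.P Kt).m + (F.P Kt).K → side (F.P Kt).L ν.M₁ k' ∣ (F.P Kt).sitesPerDir 0 →
      ∀ (s : B14.Eq218Concrete.Seq (fun n : ℕ => Node00.unionsOfCubes (F.P Kt) (side (F.P Kt).L ν.M₁ n)) k'),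
      Node00.Sect2.SeqSeparated ν.M₁ s → 0 < ν.M₁ →
      ∀ (ε₀ : ℝ) (δ : ℕ → ℝ), (∀ j, j ≤ k' → 0 < δ j ∧ δ j ≤ a₁ ∧ B₃ * δ j ≤ ε₀) → (∀ j, j < k' → δ j ≤ 2 * δ (j + 1)) →
      (∀ j, j < k' → δ (j + 1) ≤ 2 * δ j) → ε₀ ≤ a₀ →
      ∀ W : MSField (F.P Kt) SU2,
        Node00.Sect2.DataSmall7PTop (Node00.avOfRecord F 2 Kt) s.Ω (Node00.suppDomOfRecord F ν Kt s.Ω) k' δ W →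
        ∀ U₀ : GaugeField (F.P Kt) 0 SU2, IsMinimizer (Node00.avOfRecord F 2 Kt)
            {U | (∀ j, j ≤ k' → PlaqSmallOn (Node00.Sect2.omegaPlaqsTop s.Ω (Node00.suppDomOfRecord F ν Kt s.Ω) j)
                (ε₀ * (F.P Kt).eta j ^ 2) U) ∧
              Node00.Sect2.CoDivClassOnTop s.Ω (Node00.suppDomOfRecord F ν Kt s.Ω) k' ε₀ U}
            (genSet s.Ω k') W U₀ →
          (∀ j, j ≤ k' → PlaqSmallOn (Node00.Sect2.omegaPlaqsTop s.Ω (Node00.suppDomOfRecord F ν Kt s.Ω) j)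
              (B₃ * δ j * (F.P Kt).eta j ^ 2) U₀) ∧
            ∀ j, j ≤ k' → Node00.Sect2.CoDivSmallOn (Node00.Sect2.omegaBondsTop s.Ω (Node00.suppDomOfRecord F ν Kt s.Ω) j)
              (B₃ * δ j * (F.P Kt).eta j ^ 3) U₀)
    (h15EUT : ∀ (k' : ℕ), k' ≤ (F.P Kt).m + (F.P Kt).K → side (F.P Kt).L ν.M₁ k' ∣ (F.P Kt).sitesPerDir 0 →
      ∀ (s : B14.Eq218Concrete.Seq (fun n : ℕ => Node00.unionsOfCubes (F.P Kt) (side (F.P Kt).L ν.M₁ n)) k'),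
      Node00.Sect2.SeqSeparated ν.M₁ s → 0 < ν.M₁ →
      ∀ (ε₀ : ℝ) (δ : ℕ → ℝ), (∀ j, j ≤ k' → 0 < δ j ∧ δ j ≤ a₁ ∧ B₃ * δ j ≤ ε₀) → (∀ j, j < k' → δ j ≤ 2 * δ (j + 1)) →
      (∀ j, j < k' → δ (j + 1) ≤ 2 * δ j) → ε₀ ≤ a₀ →
      ∀ W : MSField (F.P Kt) SU2,
        Node00.Sect2.DataSmall7PTop (Node00.avOfRecord F 2 Kt) s.Ω (Node00.suppDomOfRecord F ν Kt s.Ω) k' δ W →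
        (∃ U₀ : GaugeField (F.P Kt) 0 SU2, IsMinimizer (Node00.avOfRecord F 2 Kt)
            {U | (∀ j, j ≤ k' → PlaqSmallOn (Node00.Sect2.omegaPlaqsTop s.Ω (Node00.suppDomOfRecord F ν Kt s.Ω) j)
                (ε₀ * (F.P Kt).eta j ^ 2) U) ∧
              Node00.Sect2.CoDivClassOnTop s.Ω (Node00.suppDomOfRecord F ν Kt s.Ω) k' ε₀ U}
            (genSet s.Ω k') W U₀) ∧
        ∀ U₁ U₂ : GaugeField (F.P Kt) 0 SU2,
          IsMinimizer (Node00.avOfRecord F 2 Kt)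
            {U | (∀ j, j ≤ k' → PlaqSmallOn (Node00.Sect2.omegaPlaqsTop s.Ω (Node00.suppDomOfRecord F ν Kt s.Ω) j)
                (ε₀ * (F.P Kt).eta j ^ 2) U) ∧
              Node00.Sect2.CoDivClassOnTop s.Ω (Node00.suppDomOfRecord F ν Kt s.Ω) k' ε₀ U}
            (genSet s.Ω k') W U₁ →
          IsMinimizer (Node00.avOfRecord F 2 Kt)
            {U | (∀ j, j ≤ k' → PlaqSmallOn (Node00.Sect2.omegaPlaqsTop s.Ω (Node00.suppDomOfRecord F ν Kt s.Ω) j)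
                (ε₀ * (F.P Kt).eta j ^ 2) U) ∧
              Node00.Sect2.CoDivClassOnTop s.Ω (Node00.suppDomOfRecord F ν Kt s.Ω) k' ε₀ U}
            (genSet s.Ω k') W U₂ →
          ∃ u : GaugeTransf (F.P Kt) 0 SU2,
            (∀ j, j ≤ k' → ∀ b ∈ bondsOf (genSet s.Ω k' j), toMS u j b.src = toMS u j b.tgt ∧ ∀ g : SU2, toMS u j b.src * g = g * toMS u j b.src) ∧
              gaugeAct u U₁ = U₂) :
    -- the per-height letters DISCHARGED (dag-n12-w6 `N12HsurjOfClass.exists_hsurjLetters`): the radius `ρ″` and the window tolerance `εH` announced from (instance, height) alone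
    ∃ ρ'' εH : ℝ, 0 < ρ'' ∧ 0 < εH ∧
    ∃ δ₀ : ℝ, 0 < δ₀ ∧
    ∀ (Λ : Set (Site (F.P Kt) 0)) (lo hi : Fin (F.P Kt).d → ℤ) (eR : ℝ), 0 < eR →
    ∀ (n : ℕ), (∀ κ, hi κ ≤ lo κ + n) → (∀ κ, ((hi κ - lo κ + 1).toNat : ℤ) + 5 < ((F.P Kt).sitesPerDir k : ℤ)) → lo ≤ hi →
      pts k Λ = (castSite '' Set.Icc lo hi : Set (Site (F.P Kt) k)) → (boxPlaqs (lo - 1) (hi + 1) : Set (Plaq (F.P Kt) k)) ⊆ plaqsInside (pts k Z) →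
    -- THE REGION BOX of the direct road (dag-n12-w6 §7's big box): `LO ≤ lo − 1`, `hi + 1 ≤ HI`, side budget `n′ < sitesPerDir k`, its plaquettes inside `Z^{(k)}`, and BOX SCOPE: every `k`-bond inside `Z^{(k)}` is a bond of the box
    -- (= print's STANDING shape condition on the class-(i) large-field components: [Balaban1988Convergent] p.255 after (2.3) «if a component of Z_j is contained in a cube of the size
    -- 100MR_j, then it is a rectangular parallelepiped», [Balaban1989LargeFieldI] (i) p.177 — lit-balaban ME #45∕#46; not a narrowing of print's instance family)
    ∀ (LO HI : Fin (F.P Kt).d → ℤ) (n' : ℕ), LO ≤ lo - 1 → hi + 1 ≤ HI → (∀ κ, HI κ ≤ LO κ + n') → n' < (F.P Kt).sitesPerDir k →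
      (boxPlaqs LO HI : Set (Plaq (F.P Kt) k)) ⊆ plaqsInside (pts k Z) → {e : PBond (F.P Kt) k | e.src ∈ pts k Z ∧ e.tgt ∈ pts k Z} ⊆ boxBonds LO HI →
    ∀ {cE : ℝ}, 12 * ((F.P Kt).d : ℝ) * ((n : ℝ) + 2) ^ 2 ≤ cE → 6 * ((((F.P Kt).d - 1 : ℕ)) : ℝ) * (F.P Kt).L ^ k * (2 * ((cE + 1) * eR)) ≤ ρ'' →
    ∀ (ext : GaugeField (F.P Kt) k SU2 → GaugeField (F.P Kt) k SU2), (∀ W, ext W = extend (pts k Λ) (shellGauge W lo hi) W) →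
    ∀ {𝓐₀ : ℝ}, 1 < 𝓐₀ →
    ∀ (εr : ℝ), 0 < εr → 12 * ((((F.P Kt).d - 1 : ℕ)) : ℝ) * (F.P Kt).L * εr ≤ ρ'' → εr ≤ εH →
      (143 * (((((F.P Kt).d + 4 : ℕ) : ℝ)) ^ 2 / 4) ^ 2) * (2 * ((F.P Kt).L : ℝ) ^ 2 * εr) ≤ 1 / 3 →
      2 * (2 * ((F.P Kt).L : ℝ) ^ 2 * εr) ≤ 2 * deltaSU (Fin 2) / ((((F.P Kt).d + 4) * (F.P Kt).L : ℕ) : ℝ) ^ 2 →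
    -- [15]'s comparability rows at `ε := 2eR`
    ∀ {ε₀ : ℝ}, (cE + 1) * (2 * eR) ≤ a₁ → B₃ * ((cE + 1) * (2 * eR)) ≤ εr → εr < ε₀ → ε₀ ≤ a₀ →
    -- the datum bond tolerance `ρn` with U3's «`T(ρn, εr) ≤ δ₀`» row (VERBATIM)
    ∀ {ρn : ℝ}, 0 ≤ ρn →
    (max ρn ((((2 * (∑ i ∈ Finset.range (k + 1), ((F.P Kt).d * (((F.P Kt).L ^ i - 1) / 2) + 1)) + 1 +
                  (3 * ((F.P Kt).d * (((F.P Kt).L - 1) / 2)) + 5) * (F.P Kt).L ^ k : ℕ) : ℝ)) ^ 2 / 4 * (εr * (F.P Kt).eta 0 ^ 2) +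
                ((3 * ((F.P Kt).d * (((F.P Kt).L - 1) / 2)) + 5 : ℕ) : ℝ) * (6 * ((((((F.P Kt).d + 2) * (F.P Kt).L : ℕ) : ℝ) ^ 2 / 4) * (2 * (εr * (F.P Kt).L ^ 2))) * ∑ i ∈ Finset.range k, ((F.P Kt).L : ℝ) ^ i) + ((3 * ((F.P Kt).d * (((F.P Kt).L - 1) / 2)) + 5 : ℕ) : ℝ) * ρn) ≤ δ₀) →
    -- the normaliser's bond tolerance (dag-n12-w6 §7, at `ε := eR`) below the datum tolerance `ρn`
    (((F.P Kt).d : ℝ) * n' + 1) * ((((F.P Kt).d - 1 : ℕ) : ℝ) * n' * ((12 * (F.P Kt).d * (n + 2) ^ 2 + 1) * eR) + 3 * (F.P Kt).d * (n + 2) ^ 2 * eR) ≤ ρn →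
    -- NO PER-BASE-FIELD HYPOTHESIS AND NO ANTECEDENT: the knit's `hMin` ∀-body for EVERY base field of the strict guard, bound `4𝓐₀`
    ∃ R : ℝ, 0 < R ∧ ∀ Vk : GaugeField (F.P Kt) k SU2, PlaqSmallOn (plaqsInside (pts k (Z ∩ Λᶜ))) eR Vk →
      ∃ Ũ : VecField (F.P Kt) k (EuclideanSpace ℂ (Fin 3)) × VecField (F.P Kt) k (EuclideanSpace ℂ (Fin 3)) → PBond (F.P Kt) 0 → Matrix (Fin 2) (Fin 2) ℂ,
        (∀ b i j, DifferentiableOn ℂ (fun z => Ũ z b i j) (ball 0 R)) ∧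
        (∀ z ∈ ball (0 : VecField (F.P Kt) k (EuclideanSpace ℂ (Fin 3)) × VecField (F.P Kt) k (EuclideanSpace ℂ (Fin 3))) R, ∀ b i j, ‖Ũ z b i j‖ ≤ 4 * 𝓐₀) ∧
        ∀ p B' : VecField (F.P Kt) k E3, ‖p‖ < R → ‖B'‖ < R → ∃ U' : GaugeField (F.P Kt) 0 SU2,
          (∀ b, Ũ (cplxVec p, cplxVec B') b = ((U' b : SU2) : Matrix (Fin 2) (Fin 2) ℂ)) ∧
            IsMinimizer (Node00.avOfRecord F 2 Kt) (Node00.regMSCoPOfRecord F 2 {ν with εreg := εr} Kt k (maxDomT ν.M₁ Z)) (Bj ν.M₁ Z k)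
              (avgFamily (Node00.avOfRecord F 2 Kt) (qsstarGIter0 k (expMul su2Chart B' (ext (expMul su2Chart p Vk))))) U' := by
  obtain ⟨ρ'', εH, hρ, hεH0, hsbU, hH⟩ := exists_hsurjLetters (F := F) (k := k) Kt hkK
  have hM1 : 1 ≤ ν.M₁ := by
    have hL := (F.P Kt).L_pos
    nlinarith
  obtain ⟨B, hB0, hHB⟩ := hH ν.M₁ hM1 Z hdiv
  obtain ⟨δ₀, hδ₀, h⟩ := exists_R_hMinRow_of_thm1Letters_alongOrbit_onZ ν Kt hd3 Z hkK hk1 hdiv hfloor hZblk hsbU hρ hHB hB0 hkc hc hMrad hM₁ h15T h15EUT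
  exact ⟨ρ'', εH, hρ, hεH0, δ₀, hδ₀, h⟩

end Summit.QuantumFields.YangMills.BalabanUVNodes.N12MinimiserFamilyKnitRowThm1LettersOnZOfRecord

end
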